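import Summits.Ventures.DiscreteObjects.Hadamard.SqrtTwoNorm668

/-!
# `4q` is not a sum of two squares in `ℚ(√2)` for a prime `q ≡ 7 (mod 8)` (uniform norm obstruction)

Framing: lottery ticket; floor = certified bounds/negative ranges.

Cell pub-namedobj (venture DiscreteObjects), target (H), hadamard gen 13.  Uniform version of `SqrtTwoNorm668` (`q = 167`): for a
prime `q ≡ 7 (mod 8)` (`2` a residue, `−1` and `−2` non-residues mod `q`; `q` splits in `ℚ(√2)` into primes inert in `ℚ(ζ₈)`):
* `even_padicValNat_sq_add_two_sq_q` — `v_q(s² + 2r²)` is even for `s² + 2r² > 0` (descent);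
* `rat_norm_obstruction_4q` — no `a, b, c, d ∈ ℚ` with `ab + cd = 0`, `a² + c² + 2(b² + d²) = 4q`;
* **`not_sum_two_sq_4q_sqrtTwo`** — `4q ≠ u² + v²` in `QuadraticAlgebra ℚ 2 0 = ℚ(√2)`.
Used by `Order4Nega4q` (no automorphism of order `4` with fixed-point-free square for any H(4q), `q ≡ 7 (mod 8)` prime:
`668 = 4·167`, `892 = 4·223`, …).  Elementary; ours; no `sorry`.
-/

namespace Summit.Ventures.DiscreteObjects.Hadamard

open Finset BigOperators

section normq
variable {q : ℕ}

/-- `−2` is not a square modulo a prime `q ≡ 7 (mod 8)` -/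
theorem neg_two_nonsquare_mod_q (hq : q.Prime) (hq8 : q % 8 = 7) : ∀ z : ZMod q, z ^ 2 ≠ -2 := by
  haveI : Fact q.Prime := ⟨hq⟩
  intro z hz
  have hns : ¬ IsSquare (-2 : ZMod q) := by
    rw [ZMod.exists_sq_eq_neg_two_iff (by omega)]
    omega
  exact hns ⟨z, by rw [← hz]; ring⟩

/-- **Descent**: `q ∣ s² + 2r²` forces `q ∣ s` and `q ∣ r` (`q ≡ 7 (mod 8)` prime). -/
theorem dvd_of_dvd_sq_add_two_sq_q (hq : q.Prime) (hq8 : q % 8 = 7) {s r : ℕ} (h : q ∣ s ^ 2 + 2 * r ^ 2) :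
    q ∣ s ∧ q ∣ r := by
  haveI : Fact q.Prime := ⟨hq⟩
  have hz : ((s : ZMod q)) ^ 2 + 2 * ((r : ZMod q)) ^ 2 = 0 := by
    have := (ZMod.natCast_eq_zero_iff (s ^ 2 + 2 * r ^ 2) q).mpr h
    push_cast at this
    exact this
  have hr : (r : ZMod q) = 0 := by
    by_contra hr
    have hsq : ((s : ZMod q) * (r : ZMod q)⁻¹) ^ 2 = -2 := by
      have hr2 : ((r : ZMod q)) ^ 2 ≠ 0 := pow_ne_zero _ hr
      field_simp
      linear_combination hz
    exact neg_two_nonsquare_mod_q hq hq8 _ hsq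
  have hs : (s : ZMod q) = 0 := by
    rw [hr] at hz
    have : ((s : ZMod q)) ^ 2 = 0 := by linear_combination hz
    exact pow_eq_zero_iff (n := 2) (by norm_num) |>.mp this
  exact ⟨(ZMod.natCast_eq_zero_iff s q).mp hs, (ZMod.natCast_eq_zero_iff r q).mp hr⟩

/-- **`v_q(s² + 2r²)` is even** for `s² + 2r² > 0` (`q ≡ 7 (mod 8)` prime). -/
theorem even_padicValNat_sq_add_two_sq_q (hq : q.Prime) (hq8 : q % 8 = 7) : ∀ K : ℕ, ∀ s r : ℕ,
    K = s ^ 2 + 2 * r ^ 2 → 0 < K → Even (padicValNat q K) := by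
  haveI : Fact q.Prime := ⟨hq⟩
  have hq1 : 1 < q := hq.one_lt
  intro K
  induction K using Nat.strong_induction_on with
  | _ K ih =>
    intro s r hK hpos
    by_cases hqK : q ∣ K
    · rw [hK] at hqK
      obtain ⟨⟨s', hs'⟩, ⟨r', hr'⟩⟩ := dvd_of_dvd_sq_add_two_sq_q hq hq8 hqK
      set K' := s' ^ 2 + 2 * r' ^ 2 with hK'
      have hKK' : K = q ^ 2 * K' := by rw [hK, hs', hr', hK']; ring
      have hK'pos : 0 < K' := by
        rcases Nat.eq_zero_or_pos K' with h0 | h0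
        · rw [hKK', h0, mul_zero] at hpos; exact absurd hpos (lt_irrefl 0)
        · exact h0
      have hlt : K' < K := by
        rw [hKK']
        have : 1 < q ^ 2 := by nlinarith
        nlinarith
      have hev := ih K' hlt s' r' hK' hK'pos
      rw [hKK', padicValNat.mul (pow_ne_zero _ hq.ne_zero) hK'pos.ne', padicValNat.prime_pow]
      exact (Nat.even_add.mpr (by simp [hev]))
    · rw [padicValNat.eq_zero_of_not_dvd hqK]
      exact Even.zero

/-- `2q` is not a sum of two natural squares for a prime `q ≡ 3 (mod 4)` -/
theorem not_sq_add_sq_two_mul_nat (hq : q.Prime) (hq4 : q % 4 = 3) : ¬ ∃ x y : ℕ, 2 * q = x ^ 2 + y ^ 2 := by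
  haveI : Fact q.Prime := ⟨hq⟩
  intro h
  rw [Nat.eq_sq_add_sq_iff] at h
  have hmem : q ∈ (2 * q).primeFactors :=
    Nat.mem_primeFactors.mpr ⟨hq, dvd_mul_left q 2, Nat.mul_ne_zero (by norm_num) hq.ne_zero⟩
  have hev := h q hmem hq4
  rw [padicValNat.mul (by norm_num) hq.ne_zero, padicValNat_self,
    padicValNat.eq_zero_of_not_dvd (fun h2 => by
      have := Nat.le_of_dvd (by norm_num) h2; omega), zero_add] at hev
  exact Nat.not_even_one hev

/-- `padicValNat q (4q) = 1` for an odd prime `q` -/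
theorem padicValNat_four_mul_self (hq : q.Prime) (hq2 : q ≠ 2) : padicValNat q (4 * q) = 1 := by
  haveI : Fact q.Prime := ⟨hq⟩
  rw [padicValNat.mul (by norm_num) hq.ne_zero, padicValNat_self,
    padicValNat.eq_zero_of_not_dvd (fun h4 => by
      have h22 : q ∣ 2 * 2 := by simpa using h4
      rcases (Nat.Prime.dvd_mul hq).mp h22 with h | h <;>
        exact hq2 ((Nat.prime_dvd_prime_iff_eq hq Nat.prime_two).mp h))]

/-- **Uniform norm obstruction**: for a prime `q ≡ 7 (mod 8)` there are no `a, b, c, d ∈ ℚ` with `ab + cd = 0` and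
`a² + c² + 2(b² + d²) = 4q`. -/
theorem rat_norm_obstruction_4q (hq : q.Prime) (hq8 : q % 8 = 7) :
    ¬ ∃ a b c d : ℚ, a * b + c * d = 0 ∧ a ^ 2 + c ^ 2 + 2 * (b ^ 2 + d ^ 2) = 4 * (q : ℚ) := by
  haveI : Fact q.Prime := ⟨hq⟩
  have hq4 : q % 4 = 3 := by omega
  rintro ⟨a, b, c, d, h1, h2⟩
  by_cases hac : a = 0 ∧ c = 0
  · obtain ⟨ha, hc⟩ := hac
    have h2q : b ^ 2 + d ^ 2 = ((2 * q : ℕ) : ℚ) := by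
      rw [ha, hc] at h2; push_cast; linarith
    exact not_sq_add_sq_two_mul_nat hq hq4 (nat_eq_sq_add_sq_of_rat h2q)
  · set m : ℚ := a ^ 2 + c ^ 2 with hm
    have hm0 : m ≠ 0 := by
      intro h0
      have ha : a = 0 := by nlinarith [sq_nonneg a, sq_nonneg c]
      have hc : c = 0 := by nlinarith [sq_nonneg a, sq_nonneg c]
      exact hac ⟨ha, hc⟩
    set t : ℚ := (a * d - b * c) / m with ht
    have hb : b = -t * c := by
      have e1 : b * m = -c * (a * d - b * c) := by rw [hm]; linear_combination a * h1
      rw [ht]; field_simp; linear_combination e1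
    have hd : d = t * a := by
      have e1 : d * m = a * (a * d - b * c) := by rw [hm]; linear_combination c * h1
      rw [ht]; field_simp; linear_combination e1
    have hkey : m * (1 + 2 * t ^ 2) = 4 * (q : ℚ) := by
      rw [hm]; rw [hb, hd] at h2; linear_combination h2
    set U : ℚ := a * (1 + 2 * t ^ 2) * t.den with hU
    set V : ℚ := c * (1 + 2 * t ^ 2) * t.den with hV
    set K : ℕ := t.den ^ 2 + 2 * t.num.natAbs ^ 2 with hK
    have htnum : (t.num : ℚ) = t * t.den := by rw [Rat.mul_den_eq_num]
    have hnumsq : ((t.num.natAbs : ℕ) : ℚ) ^ 2 = (t.num : ℚ) ^ 2 := by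
      rw [Nat.cast_natAbs, Int.cast_abs, sq_abs]
    have hkey' : (a ^ 2 + c ^ 2) * (1 + 2 * t ^ 2) = 4 * (q : ℚ) := by rw [← hm]; exact hkey
    have hUV : U ^ 2 + V ^ 2 = ((4 * q * K : ℕ) : ℚ) := by
      have eK : ((4 * q * K : ℕ) : ℚ) = 4 * (q : ℚ) * ((t.den : ℚ) ^ 2 + 2 * (t.num : ℚ) ^ 2) := by
        rw [hK]; push_cast; rw [← hnumsq]
      rw [eK, htnum, hU, hV]
      linear_combination ((1 + 2 * t ^ 2) * (t.den : ℚ) ^ 2) * hkey'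
    obtain ⟨x, y, hxy⟩ := nat_eq_sq_add_sq_of_rat hUV
    have hKpos : 0 < K := by
      have := t.den_pos
      rw [hK]; positivity
    have hsq : ∃ x y, 4 * q * K = x ^ 2 + y ^ 2 := ⟨x, y, hxy⟩
    rw [Nat.eq_sq_add_sq_iff] at hsq
    have h4q : 4 * q ≠ 0 := Nat.mul_ne_zero (by norm_num) hq.ne_zero
    have hmem : q ∈ (4 * q * K).primeFactors :=
      Nat.mem_primeFactors.mpr ⟨hq, dvd_mul_of_dvd_left (dvd_mul_left q 4) _, Nat.mul_ne_zero h4q hKpos.ne'⟩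
    have hev := hsq q hmem hq4
    rw [padicValNat.mul h4q hKpos.ne', padicValNat_four_mul_self hq (by omega)] at hev
    have hevK := even_padicValNat_sq_add_two_sq_q hq hq8 K t.den t.num.natAbs hK hKpos
    have : Even 1 := (Nat.even_add.mp hev).mpr hevK
    exact Nat.not_even_one this

/-- **`4q` is not a sum of two squares in `ℚ(√2)`** for a prime `q ≡ 7 (mod 8)`. -/
theorem not_sum_two_sq_4q_sqrtTwo (hq : q.Prime) (hq8 : q % 8 = 7) :
    ¬ ∃ u v : QuadraticAlgebra ℚ 2 0, u ^ 2 + v ^ 2 = 4 * (q : QuadraticAlgebra ℚ 2 0) := by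
  rintro ⟨u, v, h⟩
  have hre := congrArg QuadraticAlgebra.re h
  have him := congrArg QuadraticAlgebra.im h
  simp only [sq, QuadraticAlgebra.re_add, QuadraticAlgebra.re_mul, QuadraticAlgebra.im_add, QuadraticAlgebra.im_mul,
    QuadraticAlgebra.re_ofNat, QuadraticAlgebra.im_ofNat, QuadraticAlgebra.re_natCast, QuadraticAlgebra.im_natCast]
    at hre him
  refine rat_norm_obstruction_4q hq hq8 ⟨u.re, u.im, v.re, v.im, ?_, ?_⟩
  · linear_combination him / 2
  · linear_combination hre

end normq

end Summit.Ventures.DiscreteObjects.Hadamard
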